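import Mathlib

/-!
# C133 `Haitani2025` — B₀, file F1a: the mother spline (1-D block)

Towards the case-(α) ADDENDUM `¬ Step1_Display13 B₀` (UG CROSS-CHECK row 18, chair 2026-08-27T05:18:12Z):
an explicit ELEMENTARY Definition-1 system. This file is pure one-variable calculus: the mother function
`sp` = the two-piece piecewise polynomial of degree 6 on `[0,½] ∪ [½,1]` (integer coefficients), clamped
(`sp = sp' = 0` at `0` and `1`), `C¹` across `½`, extended by zero; its derivative `dsp`; `HasDerivAt`,
`ContDiff ℝ 1`; the dyadic rescalings `spS k j x = sp (2^k x − j)` and their supports. The vanishing moments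
(orders `0..6`) and the exact integrals are file F1b. Design: claims/Haitani2025/UG-AUDIT-C133-refuter8g2.md,
B0/PLAN.md. [cite: Haitani2025NavierStokesGitHub, Definition 1 p.2; (13) p.4]

WHAT THIS IS NOT: not a claim about NS regularity or blow-up; not a claim about any author beyond the typed locator.
-/

set_option linter.dupNamespace false

open Set Filter Topology

namespace Summit.NavierStokesRegularity.NavierStokesRegularity.Theorems.Haitani2025.B0

noncomputable section

/-! ### The pieces -/

/-- Left piece on `[0,½]`. [folklore] -/
def P (x : ℝ) : ℝ := -x ^ 2 + 20 * x ^ 3 - 125 * x ^ 4 + 306 * x ^ 5 - 256 * x ^ 6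

/-- Right piece on `[½,1]`. [folklore] -/
def Q (x : ℝ) : ℝ := 56 - 448 * x + 1471 * x ^ 2 - 2540 * x ^ 3 + 2435 * x ^ 4 - 1230 * x ^ 5 + 256 * x ^ 6

/-- Derivative of the left piece. [folklore] -/
def dP (x : ℝ) : ℝ := -2 * x + 60 * x ^ 2 - 500 * x ^ 3 + 1530 * x ^ 4 - 1536 * x ^ 5

/-- Derivative of the right piece. [folklore] -/
def dQ (x : ℝ) : ℝ := -448 + 2942 * x - 7620 * x ^ 2 + 9740 * x ^ 3 - 6150 * x ^ 4 + 1536 * x ^ 5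

/-- The mother: clamped two-piece `C¹` spline, extended by zero. [folklore] -/
def sp (x : ℝ) : ℝ := if x ≤ 0 then 0 else if x ≤ 1 / 2 then P x else if x ≤ 1 then Q x else 0

/-- Its derivative. [folklore] -/
def dsp (x : ℝ) : ℝ := if x ≤ 0 then 0 else if x ≤ 1 / 2 then dP x else if x ≤ 1 then dQ x else 0

/-! ### Knot values -/

/-- `P_zero` (1-D calculus for the B₀ mother spline). [folklore] -/
theorem P_zero : P 0 = 0 := by norm_num [P]
/-- `dP_zero` (1-D calculus for the B₀ mother spline). [folklore] -/
theorem dP_zero : dP 0 = 0 := by norm_num [dP]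
/-- `P_half` (1-D calculus for the B₀ mother spline). [folklore] -/
theorem P_half : P (1 / 2) = 0 := by norm_num [P]
/-- `Q_half` (1-D calculus for the B₀ mother spline). [folklore] -/
theorem Q_half : Q (1 / 2) = 0 := by norm_num [Q]
/-- `dP_half` (1-D calculus for the B₀ mother spline). [folklore] -/
theorem dP_half : dP (1 / 2) = -7 / 8 := by norm_num [dP]
/-- `dQ_half` (1-D calculus for the B₀ mother spline). [folklore] -/
theorem dQ_half : dQ (1 / 2) = -7 / 8 := by norm_num [dQ]
/-- `Q_one` (1-D calculus for the B₀ mother spline). [folklore] -/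
theorem Q_one : Q 1 = 0 := by norm_num [Q]
/-- `dQ_one` (1-D calculus for the B₀ mother spline). [folklore] -/
theorem dQ_one : dQ 1 = 0 := by norm_num [dQ]

/-! ### Derivatives of the pieces -/

/-- `P' = dP`. [folklore] -/
theorem hasDerivAt_P (x : ℝ) : HasDerivAt P (dP x) x := by
  have h := (((((hasDerivAt_pow 2 x).const_mul (-1)).add ((hasDerivAt_pow 3 x).const_mul 20)).sub
    ((hasDerivAt_pow 4 x).const_mul 125)).add ((hasDerivAt_pow 5 x).const_mul 306)).sub
    ((hasDerivAt_pow 6 x).const_mul 256)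
  refine (h.congr_of_eventuallyEq (Eventually.of_forall fun y => ?_)).congr_deriv ?_
  · simp only [P, Pi.add_apply, Pi.sub_apply]; ring
  · simp only [dP]; push_cast; ring

/-- `hasDerivAt_Q` (1-D calculus for the B₀ mother spline). [folklore] -/
theorem hasDerivAt_Q (x : ℝ) : HasDerivAt Q (dQ x) x := by
  have h := ((((((hasDerivAt_const x (56 : ℝ)).sub ((hasDerivAt_id x).const_mul 448)).add
    ((hasDerivAt_pow 2 x).const_mul 1471)).sub ((hasDerivAt_pow 3 x).const_mul 2540)).add
    ((hasDerivAt_pow 4 x).const_mul 2435)).sub ((hasDerivAt_pow 5 x).const_mul 1230)).add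
    ((hasDerivAt_pow 6 x).const_mul 256)
  refine (h.congr_of_eventuallyEq (Eventually.of_forall fun y => ?_)).congr_deriv ?_
  · simp only [Q, Pi.add_apply, Pi.sub_apply, id]
  · simp only [dQ]; push_cast; ring

/-! ### A gluing lemma -/

/-- Gluing two everywhere-differentiable functions whose values and derivatives agree at the knot `a`
gives an everywhere-differentiable function. [folklore] -/
theorem hasDerivAt_glue {g h g' h' : ℝ → ℝ} (a : ℝ) (hg : ∀ x, HasDerivAt g (g' x) x)
    (hh : ∀ x, HasDerivAt h (h' x) x) (h0 : g a = h a) (h1 : g' a = h' a) (x : ℝ) :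
    HasDerivAt (fun y => if y ≤ a then g y else h y) (if x ≤ a then g' x else h' x) x := by
  rcases lt_trichotomy x a with hlt | rfl | hgt
  · rw [if_pos hlt.le]
    refine (hg x).congr_of_eventuallyEq ?_
    filter_upwards [Iio_mem_nhds hlt] with y hy
    rw [if_pos (le_of_lt hy)]
  · rw [if_pos le_rfl]
    have hL : HasDerivWithinAt (fun y => if y ≤ x then g y else h y) (g' x) (Iic x) x :=
      (hg x).hasDerivWithinAt.congr (fun y hy => by simp [if_pos (mem_Iic.1 hy)]) (by simp)
    have hR : HasDerivWithinAt (fun y => if y ≤ x then g y else h y) (g' x) (Ici x) x := by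
      rw [h1]
      refine (hh x).hasDerivWithinAt.congr (fun y hy => ?_) (by simp [h0])
      rcases eq_or_lt_of_le (mem_Ici.1 hy) with hxy | hxy
      · subst hxy; simp [h0]
      · simp [if_neg (not_le.2 hxy)]
    have := hL.union hR
    rwa [Iic_union_Ici, hasDerivWithinAt_univ] at this
  · rw [if_neg (not_le.2 hgt)]
    refine (hh x).congr_of_eventuallyEq ?_
    filter_upwards [Ioi_mem_nhds hgt] with y hy
    rw [if_neg (not_le.2 hy)]

/-- Continuity of a glued function whose pieces agree at the knot. [folklore] -/
theorem continuous_glue {g h : ℝ → ℝ} (a : ℝ) (hg : Continuous g) (hh : Continuous h) (h0 : g a = h a) :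
    Continuous (fun y => if y ≤ a then g y else h y) :=
  Continuous.if_le hg hh continuous_id continuous_const (fun x hx => by rw [hx, h0])

/-! ### `sp` is `C¹` with derivative `dsp` -/

/-- The glue-nested form of `sp`. [folklore] -/
theorem sp_eq (x : ℝ) :
    sp x = if x ≤ 1 then (if x ≤ 1 / 2 then (if x ≤ 0 then 0 else P x) else Q x) else 0 := by
  unfold sp
  split_ifs <;> first | rfl | (exfalso; linarith)

/-- The glue-nested form of `dsp`. [folklore] -/
theorem dsp_eq (x : ℝ) :
    dsp x = if x ≤ 1 then (if x ≤ 1 / 2 then (if x ≤ 0 then 0 else dP x) else dQ x) else 0 := by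
  unfold dsp
  split_ifs <;> first | rfl | (exfalso; linarith)

/-- `sp' = dsp` everywhere. [folklore] -/
theorem hasDerivAt_sp (x : ℝ) : HasDerivAt sp (dsp x) x := by
  -- glue 0 and P at 0
  have g1 : ∀ x, HasDerivAt (fun y => if y ≤ (0:ℝ) then (0:ℝ) else P y)
      (if x ≤ 0 then (0:ℝ) else dP x) x :=
    hasDerivAt_glue 0 (fun x => hasDerivAt_const x 0) hasDerivAt_P (by simp [P_zero]) (by simp [dP_zero])
  -- glue with Q at 1/2
  have g2 : ∀ x, HasDerivAt (fun y => if y ≤ (1/2:ℝ) then (if y ≤ (0:ℝ) then (0:ℝ) else P y) else Q y)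
      (if x ≤ 1/2 then (if x ≤ 0 then (0:ℝ) else dP x) else dQ x) x :=
    hasDerivAt_glue (1/2) g1 hasDerivAt_Q (by norm_num [P_half, Q_half]) (by norm_num [dP_half, dQ_half])
  -- glue with 0 at 1
  have g3 : ∀ x, HasDerivAt
      (fun y => if y ≤ (1:ℝ) then (if y ≤ (1/2:ℝ) then (if y ≤ (0:ℝ) then (0:ℝ) else P y) else Q y) else 0)
      (if x ≤ 1 then (if x ≤ 1/2 then (if x ≤ 0 then (0:ℝ) else dP x) else dQ x) else 0) x :=
    hasDerivAt_glue 1 g2 (fun x => hasDerivAt_const x 0) (by norm_num [Q_one]) (by norm_num [dQ_one])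
  have e : sp = (fun y => if y ≤ (1:ℝ) then (if y ≤ (1/2:ℝ) then (if y ≤ (0:ℝ) then (0:ℝ) else P y) else Q y)
      else 0) := funext sp_eq
  rw [e, dsp_eq]
  exact g3 x

/-- `deriv_sp` (1-D calculus for the B₀ mother spline). [folklore] -/
theorem deriv_sp : deriv sp = dsp := funext fun x => (hasDerivAt_sp x).deriv

/-- `differentiable_sp` (1-D calculus for the B₀ mother spline). [folklore] -/
theorem differentiable_sp : Differentiable ℝ sp := fun x => (hasDerivAt_sp x).differentiableAt

/-- `continuous_sp` (1-D calculus for the B₀ mother spline). [folklore] -/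
theorem continuous_sp : Continuous sp := differentiable_sp.continuous

/-- `continuous_P` (1-D calculus for the B₀ mother spline). [folklore] -/
theorem continuous_P : Continuous P := by unfold P; fun_prop
/-- `continuous_Q` (1-D calculus for the B₀ mother spline). [folklore] -/
theorem continuous_Q : Continuous Q := by unfold Q; fun_prop
/-- `continuous_dP` (1-D calculus for the B₀ mother spline). [folklore] -/
theorem continuous_dP : Continuous dP := by unfold dP; fun_prop
/-- `continuous_dQ` (1-D calculus for the B₀ mother spline). [folklore] -/
theorem continuous_dQ : Continuous dQ := by unfold dQ; fun_prop

/-- `continuous_dsp` (1-D calculus for the B₀ mother spline). [folklore] -/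
theorem continuous_dsp : Continuous dsp := by
  have e : dsp = (fun y => if y ≤ (1:ℝ) then (if y ≤ (1/2:ℝ) then (if y ≤ (0:ℝ) then (0:ℝ) else dP y)
      else dQ y) else 0) := funext dsp_eq
  rw [e]
  refine continuous_glue 1 (continuous_glue (1/2) (continuous_glue 0 continuous_const continuous_dP ?_)
    continuous_dQ ?_) continuous_const ?_
  · simp [dP_zero]
  · norm_num [dP_half, dQ_half]
  · norm_num [dQ_one]

/-- **The mother is `C¹`.** [folklore] -/
theorem contDiff_sp : ContDiff ℝ 1 sp := by
  rw [contDiff_one_iff_deriv]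
  exact ⟨differentiable_sp, by rw [deriv_sp]; exact continuous_dsp⟩

/-! ### Support -/

/-- `sp = 0` on `(-∞,0]`. [folklore] -/
theorem sp_of_nonpos {x : ℝ} (h : x ≤ 0) : sp x = 0 := by
  unfold sp; rw [if_pos h]

/-- `sp_of_one_le` (1-D calculus for the B₀ mother spline). [folklore] -/
theorem sp_of_one_le {x : ℝ} (h : 1 ≤ x) : sp x = 0 := by
  unfold sp
  rcases eq_or_lt_of_le h with h1 | h1
  · subst h1
    rw [if_neg (by norm_num), if_neg (by norm_num), if_pos le_rfl, Q_one]
  · rw [if_neg (by linarith), if_neg (by linarith), if_neg (by linarith)]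

/-- `dsp_of_nonpos` (1-D calculus for the B₀ mother spline). [folklore] -/
theorem dsp_of_nonpos {x : ℝ} (h : x ≤ 0) : dsp x = 0 := by
  unfold dsp; rw [if_pos h]

/-- `dsp_of_one_le` (1-D calculus for the B₀ mother spline). [folklore] -/
theorem dsp_of_one_le {x : ℝ} (h : 1 ≤ x) : dsp x = 0 := by
  unfold dsp
  rcases eq_or_lt_of_le h with h1 | h1
  · subst h1
    rw [if_neg (by norm_num), if_neg (by norm_num), if_pos le_rfl, dQ_one]
  · rw [if_neg (by linarith), if_neg (by linarith), if_neg (by linarith)]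

/-- `sp_of_mem_left` (1-D calculus for the B₀ mother spline). [folklore] -/
theorem sp_of_mem_left {x : ℝ} (h0 : 0 ≤ x) (h : x ≤ 1 / 2) : sp x = P x := by
  unfold sp
  rcases eq_or_lt_of_le h0 with h0' | h0'
  · subst h0'
    rw [if_pos le_rfl, P_zero]
  · rw [if_neg (not_le.2 h0'), if_pos h]

/-- `sp_of_mem_right` (1-D calculus for the B₀ mother spline). [folklore] -/
theorem sp_of_mem_right {x : ℝ} (h : 1 / 2 ≤ x) (h1 : x ≤ 1) : sp x = Q x := by
  unfold sp
  rcases eq_or_lt_of_le h with h' | h'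
  · subst h'
    rw [if_neg (by norm_num), if_pos le_rfl, P_half, Q_half]
  · rw [if_neg (by linarith), if_neg (not_le.2 h'), if_pos h1]

/-- `dsp_of_mem_left` (1-D calculus for the B₀ mother spline). [folklore] -/
theorem dsp_of_mem_left {x : ℝ} (h0 : 0 < x) (h : x ≤ 1 / 2) : dsp x = dP x := by
  unfold dsp
  rw [if_neg (not_le.2 h0), if_pos h]

/-- `dsp_of_mem_right` (1-D calculus for the B₀ mother spline). [folklore] -/
theorem dsp_of_mem_right {x : ℝ} (h : 1 / 2 < x) (h1 : x ≤ 1) : dsp x = dQ x := by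
  unfold dsp
  rw [if_neg (by linarith), if_neg (not_le.2 h), if_pos h1]

/-! ### Dyadic rescalings -/

/-- `sp (2^k x − j)`. [folklore] -/
def spS (k j : ℕ) (x : ℝ) : ℝ := sp (2 ^ k * x - j)

/-- `dsp (2^k x − j)` (so that `(spS k j)' = 2^k · dspS k j`). [folklore] -/
def dspS (k j : ℕ) (x : ℝ) : ℝ := dsp (2 ^ k * x - j)

/-- `hasDerivAt_affine` (1-D calculus for the B₀ mother spline). [folklore] -/
theorem hasDerivAt_affine (k j : ℕ) (x : ℝ) :
    HasDerivAt (fun y : ℝ => (2:ℝ) ^ k * y - j) ((2:ℝ) ^ k) x := by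
  simpa using ((hasDerivAt_id x).const_mul ((2:ℝ) ^ k)).sub_const (j : ℝ)

/-- `hasDerivAt_spS` (1-D calculus for the B₀ mother spline). [folklore] -/
theorem hasDerivAt_spS (k j : ℕ) (x : ℝ) : HasDerivAt (spS k j) (2 ^ k * dspS k j x) x := by
  have h := (hasDerivAt_sp (2 ^ k * x - j)).comp x (hasDerivAt_affine k j x)
  have e : (sp ∘ fun y : ℝ => (2:ℝ) ^ k * y - j) = spS k j := rfl
  rw [e] at h
  simpa [dspS, mul_comm] using h

/-- `contDiff_spS` (1-D calculus for the B₀ mother spline). [folklore] -/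
theorem contDiff_spS (k j : ℕ) : ContDiff ℝ 1 (spS k j) := by
  have ha : ContDiff ℝ 1 (fun y : ℝ => (2:ℝ) ^ k * y - j) := by fun_prop
  exact contDiff_sp.comp ha

/-- `continuous_spS` (1-D calculus for the B₀ mother spline). [folklore] -/
theorem continuous_spS (k j : ℕ) : Continuous (spS k j) := (contDiff_spS k j).continuous

/-- `continuous_dspS` (1-D calculus for the B₀ mother spline). [folklore] -/
theorem continuous_dspS (k j : ℕ) : Continuous (dspS k j) := by
  unfold dspS; exact continuous_dsp.comp (by fun_prop)

/-- `two_pow_pos'` (1-D calculus for the B₀ mother spline). [folklore] -/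
theorem two_pow_pos' (k : ℕ) : (0:ℝ) < 2 ^ k := by positivity

/-- `spS_eq_zero_of_le` (1-D calculus for the B₀ mother spline). [folklore] -/
theorem spS_eq_zero_of_le {k j : ℕ} {x : ℝ} (h : x ≤ j / 2 ^ k) : spS k j x = 0 := by
  apply sp_of_nonpos
  have := (le_div_iff₀ (two_pow_pos' k)).1 h
  linarith

/-- `spS_eq_zero_of_ge` (1-D calculus for the B₀ mother spline). [folklore] -/
theorem spS_eq_zero_of_ge {k j : ℕ} {x : ℝ} (h : (j + 1) / 2 ^ k ≤ x) : spS k j x = 0 := by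
  apply sp_of_one_le
  have := (div_le_iff₀ (two_pow_pos' k)).1 h
  linarith

/-- `dspS_eq_zero_of_le` (1-D calculus for the B₀ mother spline). [folklore] -/
theorem dspS_eq_zero_of_le {k j : ℕ} {x : ℝ} (h : x ≤ j / 2 ^ k) : dspS k j x = 0 := by
  apply dsp_of_nonpos
  have := (le_div_iff₀ (two_pow_pos' k)).1 h
  linarith

/-- `dspS_eq_zero_of_ge` (1-D calculus for the B₀ mother spline). [folklore] -/
theorem dspS_eq_zero_of_ge {k j : ℕ} {x : ℝ} (h : (j + 1) / 2 ^ k ≤ x) : dspS k j x = 0 := by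
  apply dsp_of_one_le
  have := (div_le_iff₀ (two_pow_pos' k)).1 h
  linarith

/-- On its support interval the rescaled mother is the rescaled left/right piece. [folklore] -/
theorem spS_of_mem_left {k j : ℕ} {x : ℝ} (h0 : j / 2 ^ k ≤ x) (h : x ≤ (j + 1 / 2) / 2 ^ k) :
    spS k j x = P (2 ^ k * x - j) := by
  apply sp_of_mem_left
  · have := (div_le_iff₀ (two_pow_pos' k)).1 h0; linarith
  · have := (le_div_iff₀ (two_pow_pos' k)).1 h; linarith

/-- `spS_of_mem_right` (1-D calculus for the B₀ mother spline). [folklore] -/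
theorem spS_of_mem_right {k j : ℕ} {x : ℝ} (h : (j + 1 / 2) / 2 ^ k ≤ x) (h1 : x ≤ (j + 1) / 2 ^ k) :
    spS k j x = Q (2 ^ k * x - j) := by
  apply sp_of_mem_right
  · have := (div_le_iff₀ (two_pow_pos' k)).1 h; linarith
  · have := (le_div_iff₀ (two_pow_pos' k)).1 h1; linarith

end

end Summit.NavierStokesRegularity.NavierStokesRegularity.Theorems.Haitani2025.B0
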